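import Summits.AtomisticToContinuum.FouriersLaw.Theorems.PhononMeanFreePathDefs
import Summits.AtomisticToContinuum.FouriersLaw.Theorems.BondHeatUncertaintySubdiffusiveBondHeatKernelDetailedBalance
import Summits.AtomisticToContinuum.FouriersLaw.Theorems.PhononMeanFreePathIncoherentChannelLightConeHelper2
import Summits.AtomisticToContinuum.FouriersLaw.Theorems.PhononMeanFreePathCoherentDephasingStrictAbsorptionStatics

/-!
# `CoherentDephasing` / line `Sketch`: the coherent momentum field never exceeds the kick (stub `sum_momResp_sq_le`)

Registered stub `sum_momResp_sq_le` of line `Sketch` of crux `PhononMeanFreePath.CoherentDephasing`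
(stmt-AtomisticToContinuum-11810). For the `(N+1)`-site pinned anharmonic chain `P = pinnedChain ω₂ lam β γ`
with both Langevin baths at `T`, Gibbs law `μ = P.gibbsMeasure (N+1) T` and constructed kernels
`K_t = P.transitionKernel (N+1) T T t⁺`, the momentum component of the coherent response field is
`m_x(t) = ⟨p₀, K_t p_x⟩_μ = momResp … N x t`. CLAIM: `Σ_x m_x(t)² ≤ T²` for every `N` and every `t`
(uniformly in `N`, pointwise in time).

PROOF. (1) Kernel detailed balance in `L²(μ)` (`SubdiffusiveBondHeat.pinnedChain_detailedBalance`, `Θ(q,p) = (q,-p)`,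
both momenta odd): `m_x(t) = ⟨p_x, g⟩_μ` with the single function `g = K_t p₀`. (2) Bessel's inequality in `L²(μ)`
for the orthogonal family `{p_x}` (`∫ p_x p_y dμ = T δ_{xy}`, Gaussian momentum statics):
`Σ_x ⟨p_x, g⟩² ≤ T ‖g‖²_{L²(μ)}` (`bessel_sum_sq_le`, the non-negativity of `∫ (Σ_x a_x p_x - T g)² dμ`).
(3) `L²(μ)`-contraction of the Markov kernel under its invariant law: `‖K_t p₀‖² ≤ ‖p₀‖² = T`
(`SubdiffusiveBondHeat.pinnedChain_sq_act_le_of_sq_integrable`). Hence `Σ_x m_x(t)² ≤ T · T`.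
-/

noncomputable section

open MeasureTheory ProbabilityTheory Set Filter Topology
open scoped NNReal ENNReal

namespace Summit.AtomisticToContinuum.FouriersLaw.Theorems.CoherentDephasing.CoherentEnergyPointwise

open Literature.MathematicalPhysics.KineticTheory.HeatConduction
open Summit.AtomisticToContinuum.FouriersLaw.Theorems.PhononMeanFreePath

/-- **Bessel's inequality for a finite orthogonal family of equal norms**, integral form: if
`∫ e_i e_j dμ = T [i = j]` (`T > 0`) and `g² ∈ L¹(μ)` (with the products `e_i e_j`, `e_i g` integrable), then
`Σ_i (∫ e_i g dμ)² ≤ T ∫ g² dμ` — the non-negativity of `∫ (Σ_i a_i e_i - T g)² dμ` at `a_i = ∫ e_i g dμ`.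
[folklore] -/
theorem bessel_sum_sq_le {α ι : Type*} [MeasurableSpace α] [Fintype ι] [DecidableEq ι] {μ : Measure α}
    {e : ι → α → ℝ} {g : α → ℝ} {T : ℝ} (hT : 0 < T)
    (hee : ∀ i j, Integrable (fun z => e i z * e j z) μ) (heg : ∀ i, Integrable (fun z => e i z * g z) μ)
    (hg2 : Integrable (fun z => g z ^ 2) μ) (horth : ∀ i j, ∫ z, e i z * e j z ∂μ = if i = j then T else 0) :
    ∑ i, (∫ z, e i z * g z ∂μ) ^ 2 ≤ T * ∫ z, g z ^ 2 ∂μ := by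
  set a : ι → ℝ := fun i => ∫ z, e i z * g z ∂μ with ha
  set h : α → ℝ := fun z => ∑ i, a i * e i z with hh
  -- integrability of `h g` and `h²`
  have hIhg : Integrable (fun z => h z * g z) μ := by
    have e1 : (fun z => h z * g z) = fun z => ∑ i, a i * (e i z * g z) := by
      funext z
      simp only [hh, Finset.sum_mul]
      exact Finset.sum_congr rfl fun i _ => by ring
    rw [e1]
    exact integrable_finsetSum _ fun i _ => (heg i).const_mul (a i)
  have hIh2 : Integrable (fun z => h z ^ 2) μ := by
    have e2 : (fun z => h z ^ 2) = fun z => ∑ i, ∑ j, a i * a j * (e i z * e j z) := by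
      funext z
      simp only [hh, sq, Finset.sum_mul_sum]
      exact Finset.sum_congr rfl fun i _ => Finset.sum_congr rfl fun j _ => by ring
    rw [e2]
    exact integrable_finsetSum _ fun i _ => integrable_finsetSum _ fun j _ => (hee i j).const_mul _
  -- `∫ h g = Σ a_i²`
  have i1 : ∫ z, h z * g z ∂μ = ∑ i, a i ^ 2 := by
    have e1 : (fun z => h z * g z) = fun z => ∑ i, a i * (e i z * g z) := by
      funext z
      simp only [hh, Finset.sum_mul]
      exact Finset.sum_congr rfl fun i _ => by ring
    rw [e1, integral_finsetSum _ fun i _ => (heg i).const_mul (a i)]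
    refine Finset.sum_congr rfl fun i _ => ?_
    rw [integral_const_mul, sq]
  -- `∫ h² = T Σ a_i²`
  have i2 : ∫ z, h z ^ 2 ∂μ = T * ∑ i, a i ^ 2 := by
    have e2 : (fun z => h z ^ 2) = fun z => ∑ i, ∑ j, a i * a j * (e i z * e j z) := by
      funext z
      simp only [hh, sq, Finset.sum_mul_sum]
      exact Finset.sum_congr rfl fun i _ => Finset.sum_congr rfl fun j _ => by ring
    rw [e2, integral_finsetSum _ fun i _ => integrable_finsetSum _ fun j _ => (hee i j).const_mul _,
      Finset.mul_sum]
    refine Finset.sum_congr rfl fun i _ => ?_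
    rw [integral_finsetSum _ fun j _ => (hee i j).const_mul _]
    simp_rw [integral_const_mul, horth, mul_ite, mul_zero]
    rw [Finset.sum_ite_eq]
    simp [sq]
    ring
  -- `0 ≤ ∫ (h - T g)² = T Σ a² - 2 T Σ a² + T² ∫ g²`
  have hnn : 0 ≤ ∫ z, (h z - T * g z) ^ 2 ∂μ := integral_nonneg fun z => sq_nonneg _
  have e3 : (fun z => (h z - T * g z) ^ 2) = fun z => (h z ^ 2 - 2 * T * (h z * g z)) + T ^ 2 * g z ^ 2 := by
    funext z; ring
  have hA : Integrable (fun z => h z ^ 2 - 2 * T * (h z * g z)) μ := hIh2.sub (hIhg.const_mul _)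
  rw [e3, integral_add hA (hg2.const_mul _), integral_sub hIh2 (hIhg.const_mul _),
    integral_const_mul, integral_const_mul, i1, i2] at hnn
  have h1 : T * ∑ i, a i ^ 2 ≤ T * (T * ∫ z, g z ^ 2 ∂μ) := by linarith
  exact le_of_mul_le_mul_left h1 hT

/-- **The coherent momentum field carries at most the kick (registered stub `sum_momResp_sq_le`).** For the pinned
anharmonic chain with both baths at `T > 0`, every `N` and every `t > 0`:
`Σ_{x=0}^{N} m_x(t)² ≤ T²`, `m_x(t) = ⟨p₀, K_t p_x⟩_μ`. Detailed balance turns `m_x(t)` into `⟨p_x, K_t p₀⟩_μ`,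
Bessel's inequality for the orthogonal momenta (`∫ p_x p_y dμ = T δ_{xy}`) bounds the sum by `T ‖K_t p₀‖²_{L²(μ)}`,
and the `L²(μ)`-contraction of `K_t` under its invariant Gibbs law gives `‖K_t p₀‖² ≤ ‖p₀‖² = T`. [folklore] -/
theorem sum_momResp_sq_le :
    ∀ ω₂ lam β γ : ℝ, 0 < ω₂ → 0 < lam → 0 < β → 0 < γ → ∀ T : ℝ, 0 < T → ∀ (N : ℕ) (t : ℝ), 0 < t →
      ∑ x : Fin (N + 1), momResp ω₂ lam β γ T N x t ^ 2 ≤ T ^ 2 := by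
  intro ω₂ lam β γ hω hl hβ hγ T hT N t _
  set μ := (pinnedChain ω₂ lam β γ).gibbsMeasure (N + 1) T with hμ
  set κ := (pinnedChain ω₂ lam β γ).transitionKernel (N + 1) T T t.toNNReal with hκ
  have hpm : ∀ x : Fin (N + 1), Measurable fun z : PhaseSpace (N + 1) => z.2 x := fun x =>
    (measurable_pi_apply x).comp measurable_snd
  have hp2 : ∀ x : Fin (N + 1), Integrable (fun z : PhaseSpace (N + 1) => z.2 x ^ 2) μ := fun x =>
    lightCone_integrable_momentum_pow hω hl.le hβ.le hT x 2
  -- the `L²(μ)`-contraction of `K_t` on `p₀`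
  obtain ⟨-, hG2, hGle⟩ := SubdiffusiveBondHeat.pinnedChain_sq_act_le_of_sq_integrable hω hl hβ hγ (Nat.succ_pos N)
    hT (hpm 0) (hp2 0) t.toNNReal
  set g : PhaseSpace (N + 1) → ℝ := fun z => ∫ y, y.2 0 ∂κ z with hg
  have hgm : Measurable g := ((hpm 0).stronglyMeasurable.integral_kernel (κ := κ)).measurable
  have hT0 : ∫ z : PhaseSpace (N + 1), z.2 0 ^ 2 ∂μ = T :=
    pinnedChain_integral_momentum_sq_gibbsMeasure hω hl.le hβ.le (N + 1) hT 0 (γ := γ)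
  have hGT : ∫ z, g z ^ 2 ∂μ ≤ T := hT0 ▸ hGle
  -- (1) detailed balance: `m_x(t) = ⟨p_x, K_t p₀⟩_μ`
  have ha : ∀ x : Fin (N + 1), momResp ω₂ lam β γ T N x t = ∫ z, z.2 x * g z ∂μ := by
    intro x
    have h := SubdiffusiveBondHeat.pinnedChain_detailedBalance hω hl hβ hγ (Nat.succ_pos N) hT (hpm 0) (hpm x)
      (hp2 0) (hp2 x) t.toNNReal
    show ∫ z, z.2 0 * (∫ y, y.2 x ∂κ z) ∂μ = _
    rw [h]
    refine integral_congr_ae (Eventually.of_forall fun z => ?_)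
    simp only [Pi.neg_apply, integral_neg, hg]
    ring
  -- (2) Gaussian momentum statics and integrability of the products
  have horth : ∀ x y : Fin (N + 1), ∫ z : PhaseSpace (N + 1), z.2 x * z.2 y ∂μ = if x = y then T else 0 := by
    intro x y
    by_cases hxy : x = y
    · subst hxy
      rw [if_pos rfl, ← pinnedChain_integral_momentum_sq_gibbsMeasure hω hl.le hβ.le (N + 1) hT x (γ := γ)]
      exact integral_congr_ae (Eventually.of_forall fun z => by simp only [sq])
    · rw [if_neg hxy]
      have h := StrictAbsorption.statics_integral_momentum_mul_momentum_mul_posFun hω hl.le hβ.le γ (N + 1) hT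
        (j := x) (i := y) (fun h => hxy h.symm) (G := fun _ => (1 : ℝ)) continuous_const (C := 1) fun z => by
          rw [abs_one, one_mul]
          exact one_le_pow₀ (by linarith [pinnedChain_hamiltonian_nonneg hω.le hl.le hβ.le γ (N + 1) z])
      simpa using h
  have hee : ∀ x y : Fin (N + 1), Integrable (fun z : PhaseSpace (N + 1) => z.2 x * z.2 y) μ := fun x y =>
    SubdiffusiveBondHeat.integrable_mul_of_sq_aesm (hpm x).aestronglyMeasurable (hpm y).aestronglyMeasurable
      (hp2 x) (hp2 y)
  have heg : ∀ x : Fin (N + 1), Integrable (fun z : PhaseSpace (N + 1) => z.2 x * g z) μ := fun x =>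
    SubdiffusiveBondHeat.integrable_mul_of_sq_aesm (hpm x).aestronglyMeasurable hgm.aestronglyMeasurable
      (hp2 x) hG2
  -- (3) Bessel + contraction
  have hB := bessel_sum_sq_le (e := fun (x : Fin (N + 1)) (z : PhaseSpace (N + 1)) => z.2 x) hT hee heg hG2 horth
  calc ∑ x : Fin (N + 1), momResp ω₂ lam β γ T N x t ^ 2
      = ∑ x : Fin (N + 1), (∫ z, z.2 x * g z ∂μ) ^ 2 := Finset.sum_congr rfl fun x _ => by rw [ha x]
    _ ≤ T * ∫ z, g z ^ 2 ∂μ := hB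
    _ ≤ T * T := mul_le_mul_of_nonneg_left hGT hT.le
    _ = T ^ 2 := (sq T).symm

end Summit.AtomisticToContinuum.FouriersLaw.Theorems.CoherentDephasing.CoherentEnergyPointwise

end
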